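import Summits.BirchSwinnertonDyer.Rank1Residual.GaloisImage.KuriharaRecordBSDpThreeLevelOne
import Summits.BirchSwinnertonDyer.Rank1Residual.GaloisImage.KolyvaginLevelOneNineDividesOfBaseRigidity
import Summits.BirchSwinnertonDyer.Rank1Residual.GaloisImage.KuriharaLowerBoundThreeOfKolyvaginProductCyclic
import HarnessLib

/-!
# R1-57-B, part 3: the END-m1 RECORD COROLLARIES, [S24]-FREE (base-rigidity form)
# (cell `b2b-bsdres`, team n1011, ROUTE-1 §33.3 / §34.3 sub-targets R1-57 / R1-58; row T-R1-57-B; seat p18)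

HONEST FRAMING (cell `b2b-bsdres`, run/shared/lean/b2b/bsd-rank1-residual/, verbatim in every
file): the goal of the cell is to DELETE the COMBINATION-SHAPED residual classes of the
Birch–Swinnerton-Dyer formula for ALL analytic-rank `≤ 1` elliptic curves over `ℚ` — "full BSD
formula for every rank `≤ 1` curve in class `C`" assembled STRICTLY from published theorems — so
that the rank-`≤ 1` remainder becomes exactly the CONSTRUCTION-SHAPED classes, which are TYPED
(missing-input `Prop`s), NOT attempted. This is not "finishing BSD". Team n1011 (N10/N11, the
additive block `X4 ∧ p = 3`): research route; PER-PAIR record shape, NOT a class theorem; TOOL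
theorems only (no definition, no named fact); nothing booked; no mark / label moved.  END-m1 is
WEAKER than the S24-DEEP pair END (`BSD(E,3)` only where `ord₃(L(E,1)/Ω_E) ≤ 2`) — DEBT REDUCTION,
not coverage: CONDITIONAL on the UPPER-half facts of the X4 chain of record (`hKatoS hDel hmodD
hKatoχ`; `hGZK hmod h26`), Cassels–Tate (`hCT`), the Poitou–Tate family at `3`, Tate's `hEP`, and the
ONE port `KatoKuriharaPortThreeAt W 0 v₃` (FLAG `K22-Thm3.13-PORT@3`, construction-shaped) — and on
NO [S24] fact of any level: the injectivity at the core vertex `∅` is n1011-p11's BASE RIGIDITY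
(R1-58, p290143; no coisotropy, no four-class Chebotarev choice), consumed through n1011-p09's
`exists_ne_zero_mem_selmerGroup_three_of_dictionaryOne_of_levelOne_certificate_of_baseRigidity`.
The certificate lines are per-record EVIDENCE.

## What and why (r1 ROUTE-1 §33.3 RECORD COROLLARY; §34.3 BR; lead R5-68 (a)(b); referee 1 GEN 22)

`KuriharaRecordBSDpThreeLevelOneEnd` (p290368) landed the END-m1 record corollaries in their interim
`…_of_S24` form (one [S24] fact through p09's interim injectivity).  n1011-p09 GEN 7 swapped the
injectivity to p11's base rigidity (`KolyvaginLevelOneNineDividesOfBaseRigidity`); this file is the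
twin of p290368 with `hS24` and `hunro` DELETED — same proofs, same binders otherwise (the `_of_S24`
forms stay, referee 1 GEN 22):

* `Assembly.exists_ne_zero_mem_selmerGroup_three_of_port_of_kolyvaginProduct_of_baseRigidity`,
* `Assembly.bsdp_three_of_towerSurj_of_levelOneCertificates_of_baseRigidity` (potgood, unit),
* `Assembly.bsdp_three_potMult_of_levelOneCertificates_of_baseRigidity` ((M) rows).

NET per certified END-m1 row vs the pair END: −2 [S24] named facts (Thm. 4.4 (1)(2) at all levels),
−5 `inv′` binders, −`hL20`, + `hCT` (PUB); the PORT debt and the UPPER facts unchanged.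

References: C.-H. Kim, AJM 148 (2026) Thm. 1.9 (6), Thm. 3.13 [Kim2022StructureSelmer]; K. Rubin,
PCMI 18 (2011) Thm. 2.8.4 [Rubin2011]; K. Kato, Astérisque 295 (2004) Thm. 14.5 (3)
[Kato2004Asterisque]; A. Agashe, K. Ribet, W. Stein (2006) Thm. 2.6 [AgasheRibetStein2006];
J. H. Silverman, AEC (2009) X.4.2, X.4.14 [SilvermanAEC2009]; R. L. Miller, LMS JCM 14 (2011)
Def. 1.1 [Miller2011LMS].
-/

noncomputable section

open scoped Classical NumberField ContRepresentation
open Function Field NumberField IsDedekindDomain IsDedekindDomain.HeightOneSpectrum WeierstrassCurve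
  CongruenceSubgroup
  Literature.NumberTheory.EllipticCurves Literature.NumberTheory.EllipticCurves.ModularForms
  Literature.NumberTheory.EllipticCurves.Rank1Residual
  Literature.NumberTheory.EllipticCurves.AgasheRibetStein2006
  Literature.NumberTheory.GaloisRepresentations
  Literature.NumberTheory.GaloisRepresentations.DiscreteGaloisModule Literature.NumberTheory.GaloisCohomology
  Rat.HeightOneSpectrum
  Summit.BirchSwinnertonDyer.Rank1Residual.Additive Summit.BirchSwinnertonDyer.Rank1Residual.X4
open Literature.NumberTheory.DiophantineGeometry.Dioph (ratModP)

namespace Summit.BirchSwinnertonDyer.Rank1Residual.GaloisImage.Assembly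

/-! ### The level-one datum behind the port: `Sel₃(E) ≠ 0` in record currency -/

/-- **`Sel₃(E) ≠ 0` from ONE level-one Kurihara unit, in RECORD currency — [S24]-FREE form (base rigidity).**
`W/ℚ` globally minimal, additive at `3` with `3 ∤ c₃`, surj(3), `#E(ℚ₃)[3] = 1`; the Poitou–Tate
family at `3` (four properties), Tate's `hEP`, the ONE port `KatoKuriharaPortThreeAt W 0 v₃`, a
parametrisation datum `D` with `3 ∤ c_D` and the unit period transfer; `3 ∣ [0]⁺`
(`kuriharaNumber D.f 3 1 ψ = 0`); and ONE `n ∈ 𝒩₁(E,3)` with B1's cyclicity flag at its primes and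
`δ̃_n(ψ) ≢ 0 (mod 3)` for surjective `ψ`.  THEN `Sel^(3)(E/ℚ) ≠ 0` — n1011-p09's END-m1
`exists_ne_zero_mem_selmerGroup_three_of_dictionaryOne_of_levelOne_certificate_of_baseRigidity`
(injectivity at `∅` by n1011-p11's R1-58 BASE RIGIDITY p290143 — no [S24], no coisotropy, no
four-class choice) fed with B1's datum (τ from surj(3), `T = {v ∣ 3} ∪ {bad}`, the canonical comparison maps), the level of `n`
in Sakamoto's `τ`-class (`FrobShape.exists_level_of_kolyvaginProduct`) and DICT3₁ from the port
(`dictionaryThreeOneAt_of_port`).  NO [S24] fact anywhere in the dependence cone of this theorem.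
[cite: Kim2022StructureSelmer, Thm. 3.13] [cite: Rubin2011, Thm. 2.8.4] -/
theorem exists_ne_zero_mem_selmerGroup_three_of_port_of_kolyvaginProduct_of_baseRigidity
    (W : WeierstrassCurve ℚ) [W.IsElliptic] [W.IsGloballyMinimal]
    (hadd : haveI : Fact (Nat.Prime 3) := ⟨Nat.prime_three⟩; Addv W 3)
    (hc3 : ¬ 3 ∣ (W.baseChange ℚ_[3]).localTamagawaNumber ℤ_[3])
    (hsurj : W.HasSurjectiveModNGaloisRep ((3 : ℕ) : ℤ))
    (ht0 : Nat.card {Q : (W.baseChange ℚ_[3]).toAffine.Point // (3 : ℕ) • Q = 0} = 1)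
    {N : ℕ} [NeZero N] (D : ModularParametrizationData W N)
    (hcP : ¬ ((3 : ℕ) : ℤ) ∣ D.maninConstant)
    (hper : ∃ u : ℚ, ‖(u : ℚ_[3])‖ = 1 ∧ W.realPeriodRat = u * plusPeriod D.f)
    (inv : LocalInvariants ℚ 3) (hperf : inv.IsPerfect) (hsum : inv.SumLocalTermEqZero)
    (hcompl : inv.SelmerComplement)
    (hEP : ∀ v : HeightOneSpectrum (𝓞 ℚ), localEulerPoincareCharacteristic (v.adicCompletion ℚ))
    (v₃ : HeightOneSpectrum (𝓞 ℚ)) (hv₃ : ((3 : ℕ) : 𝓞 ℚ) ∈ v₃.asIdeal)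
    (hPort : KatoKuriharaPortThreeAt W 0 v₃)
    (n : ℕ) [NeZero n] (hn : Kato.IsKolyvaginProduct W 3 1 n)
    (hcyc : ∀ (ℓ : ℕ) [Fact ℓ.Prime], ℓ ∣ n →
      Nat.card {P : ((integralModelInt W).map (Int.castRingHom (ZMod ℓ))).toAffine.Point //
        3 • P = 0} ≤ 3)
    (ψ : (ℓ : ℕ) → (ZMod ℓ)ˣ →* Multiplicative (ZMod (3 ^ 1)))
    (hψ : ∀ ℓ ∈ n.primeFactors, Function.Surjective (ψ ℓ))
    (hcert : kuriharaNumber D.f (3 ^ 1) n ψ ≠ 0)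
    (hzero₁ : kuriharaNumber D.f (3 ^ 1) 1 ψ = 0) :
    ∃ x ∈ (W.kummerSelmerStructure ((3 : ℕ) : ℤ)).selmerGroup, x ≠ 0 := by
  haveI : Fact (Nat.Prime 3) := ⟨Nat.prime_three⟩
  -- the admissible set `T = {v ∣ 3} ∪ {bad}`, `S = S(T)`; `E[3]` finite
  obtain ⟨T, h3T, hbadT, hTmem, -, -, -, hfinT, -⟩ := TowerPackage.towerAdmissible W
  haveI : Finite (geomTorsion W ((3 : ℕ) : ℤ)) := hfinT 0
  have h3S : ∀ v : HeightOneSpectrum (𝓞 ℚ), ((3 : ℕ) : 𝓞 ℚ) ∈ v.asIdeal →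
      (Sum.inr v : Place ℚ) ∈ finSupport T := fun v hv => (inr_mem_finSupport_iff T v).mpr (h3T v hv)
  have hbadS : ∀ v : HeightOneSpectrum (𝓞 ℚ), ¬ W.HasGoodReductionAt v →
      (Sum.inr v : Place ℚ) ∈ finSupport T := fun v hv => (inr_mem_finSupport_iff T v).mpr (hbadT v hv)
  have hSgood : ∀ v ∉ {v : HeightOneSpectrum (𝓞 ℚ) | (Sum.inr v : Place ℚ) ∈ finSupport T},
      W.HasGoodReductionAt v ∧ ((3 : ℕ) : 𝓞 ℚ) ∉ v.asIdeal := fun v hv =>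
    ⟨by_contra fun h => hv (hbadS v h), fun h => hv (h3S v h)⟩
  -- `τ` at level one from surj(3); the canonical datum `D₁` (B1)
  obtain ⟨τ, hτ, hτq⟩ := exists_rootsOfUnityFixer_cokerSubOne_equiv_zmod_three_of_surj W hsurj
  have hτμ : τ ∈ rootsOfUnityFixer ℚ 3 := hτ 3 (by norm_num)
  obtain ⟨η, D₁, hP, hT, hD⟩ :=
    FSComp.exists_eta_kolyvaginDatum_hasCanonicalComparison_frobeniusClassPrimes
      (W.torsionGaloisModule ((3 : ℕ) : ℤ)) 3 {v | (Sum.inr v : Place ℚ) ∈ finSupport T} hτμ hτq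
      (cyclotomicTransverse (W.torsionGaloisModule ((3 : ℕ) : ℤ)))
  -- DICT3₁ for `D₁` from the port
  have hDict : KatoKuriharaDictionaryThreeOneAt W 0 D₁ v₃ :=
    dictionaryThreeOneAt_of_port W hPort hSgood hτμ hτq hP hT hD
  -- the level of `n` in the `τ`-class (Kim's `𝒩₁` + the cyclicity flag ⟹ Sakamoto's class)
  have hflag : ∀ v : HeightOneSpectrum (𝓞 ℚ), Ideal.absNorm v.asIdeal ∣ n →
      Nat.card (AddSubgroup.torsionBy (W.reductionAt v).toAffine.Point (3 : ℕ)) ≤ 3 :=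
    fun v hv => natCard_torsionBy_reductionAt_le_of_dvd W 3 hcyc hv
  have hnS : ∀ v : HeightOneSpectrum (𝓞 ℚ), Ideal.absNorm v.asIdeal ∣ n →
      v ∉ {v : HeightOneSpectrum (𝓞 ℚ) | (Sum.inr v : Place ℚ) ∈ finSupport T} := by
    intro v hv hvS
    obtain ⟨hgood, h3v⟩ := hasGoodReductionAt_and_not_mem_of_kolyvaginProduct W 3 hn hv
    rcases hTmem v ((inr_mem_finSupport_iff T v).mp hvS) with h | h
    · exact h hgood
    · exact h3v h
  have hτμ' : τ ∈ rootsOfUnityFixer ℚ (3 ^ 1) := hτ (3 ^ 1) (by norm_num)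
  obtain ⟨nF, hnF, hprod, hmem⟩ := FrobShape.exists_level_of_kolyvaginProduct W 3 (K := 1) one_pos hn
    hflag ((3 : ℕ) : ℤ) (by norm_num) hsurj hτμ' hτq hnS
  have hlevel : D₁.IsLevel nF := by
    show (↑nF : Set (HeightOneSpectrum (𝓞 ℚ))) ⊆ D₁.primes
    rw [hP]
    simpa using hnF
  -- the certificate at the level `nF`, and `3 ∣ [0]⁺`
  have hψ₀ : ∀ q ∈ nF, Function.Surjective (ψ (Ideal.absNorm q.asIdeal)) :=
    fun q hq => hψ _ (hmem q hq)
  have hcert' : ∀ (m : ℕ) (inst : NeZero m), m = n → @kuriharaNumber _ D.f 3 m inst ψ ≠ 0 := by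
    rintro m inst rfl
    exact hcert
  have hzero : ratModP 3 (ratPlusSymbol D.f 0) = 0 := by
    have h := hzero₁
    rw [kuriharaNumber_one] at h
    exact h
  exact exists_ne_zero_mem_selmerGroup_three_of_dictionaryOne_of_levelOne_certificate_of_baseRigidity W
    hsurj τ hτμ hτq inv hperf hsum hcompl hEP (finSupport T) (inl_mem_finSupport T) h3S hbadS
    D₁ η hP hT hD v₃ hv₃ hDict hadd hc3 ht0 D hcP hper hzero nF hlevel hψ₀ (hcert' _ _ hprod)

/-! ### The END-m1 record corollaries -/

/-- **END-m1, RECORD COROLLARY (r1 ROUTE-1 §33.3): `BSD(E,3)` on a class-A1 row from ONE level-one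
Kurihara unit and two level-zero fields — [S24]-FREE form.**  `W/ℚ` globally minimal with
integral model `E₀` ADDITIVE at `3` (`3 ∣ Δ`, `3 ∣ c₄`), the `3`-adic tower (UPPER side),
`E(ℚ₃)[3] = 0`, analytic rank `0`, `3 ∤ ∏ c_ℓ`, an OPTIMAL datum at `N ≤ 130000`; the UPPER-half
facts of the X4 chain of record; NO [S24] fact of any level (injectivity at `∅` = n1011-p11's base
rigidity R1-58), NO `inv′` family; Cassels–Tate; the Poitou–Tate family at `3`
(`hperf hsum hcompl`), Tate's `hEP`; ONE port `KatoKuriharaPortThreeAt W 0 v₃`; and the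
CERTIFICATE: ONE `n ∈ 𝒩₁(E,3)` (any number of primes) with the cyclicity flag
`#(E₀ mod ℓ)(𝔽_ℓ)[3] ≤ 3` at its primes, surjective `ψ`, `δ̃_n(ψ) ≢ 0 (mod 3)`, and the two
level-zero fields `δ̃_1 ≡ 0 (mod 3)`, `δ̃_1 ≢ 0 (mod 27)`.  THEN `BSD(E, 3)`.  Binders = the pair
END `bsdp_three_of_towerSurj_of_pairCertificate`'s MINUS {hS24, hS24₂, inv′ ×4 (+ injectivity), hn2,
hNE, hε, hL20} PLUS {hCT, hzero₁, ψ₂₇ + hunit₁} — nothing else; −2 [S24] named facts per row.  (Lower half: p09's END-m1 ⟹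
`Sel₃ ≠ 0` ⟹ `9 ∣ #Ш(3)`; `27 ∤ [0]⁺` ⟹ `ord₃(L/Ω) ≤ 2 ≤ ord₃ #Ш(3)`; UPPER: additive-p4's socket.)
[cite: Kim2022StructureSelmer, Thm. 1.9 (6) and Thm. 3.13] [cite: Rubin2011, Thm. 2.8.4]
[cite: Kato2004Asterisque, Thm. 14.5 (3) (p. 236)] [cite: AgasheRibetStein2006, Thm. 2.6 (p. 619)]
[cite: SilvermanAEC2009, Thm. X.4.14] -/
theorem bsdp_three_of_towerSurj_of_levelOneCertificates_of_baseRigidity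
    (hKatoS : Kato2004.rankZero_padicValNat_sha_le_sub_localTamagawa_of_additive_potGood_of_imageContainsSL2)
    (hDel : Delbourgo1998.prop4_rankZero_pow_dvd_constantCoeff)
    (hGZK : rank_eq_analyticRank_of_analyticRank_le_one) (hmod : hasEntireLFunction_rat)
    (hmodD : nonempty_modularParametrizationData)
    (hKatoχ : Wuthrich2014.kato_halfEigenCharIdeal_dvd_cyclotomicPrime_of_surjective)
    (h26 : cremona_abs_maninConstant_eq_one_of_level_le)
    (hCT : exists_casselsTate_pairing (K := ℚ))
    (W : WeierstrassCurve ℚ) [W.IsElliptic] [W.IsGloballyMinimal]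
    -- the row
    {E₀ : WeierstrassCurve ℤ} (hI : integralModelInt W = E₀)
    (hΔ : (3 : ℤ) ∣ E₀.Δ) (hc₄ : (3 : ℤ) ∣ E₀.c₄)
    (htower : ∀ m : ℕ, W.HasSurjectiveModNGaloisRep (3 ^ m : ℕ))
    (ht0 : Nat.card {Q : (W.baseChange ℚ_[3]).toAffine.Point // (3 : ℕ) • Q = 0} = 1)
    (hr : W.analyticRank = 0) (htam : ¬ 3 ∣ W.tamagawaProduct)
    {N : ℕ} [NeZero N] (hN : N ≤ 130000) (D : ModularParametrizationData W N)
    (hopt : ∀ z ∈ D.L.lattice, ∃ w ∈ periodLattice D.f, z = D.c * w)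
    -- the Poitou–Tate family at `3`, Tate's local Euler characteristic, ONE port
    (inv : LocalInvariants ℚ 3) (hperf : inv.IsPerfect) (hsum : inv.SumLocalTermEqZero)
    (hcompl : inv.SelmerComplement)
    (hEP : ∀ v : HeightOneSpectrum (𝓞 ℚ), localEulerPoincareCharacteristic (v.adicCompletion ℚ))
    (v₃ : HeightOneSpectrum (𝓞 ℚ)) (hv₃ : ((3 : ℕ) : 𝓞 ℚ) ∈ v₃.asIdeal)
    (hPort : KatoKuriharaPortThreeAt W 0 v₃)
    -- the certificate: ONE level-one unit, two level-zero fields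
    (n : ℕ) [NeZero n] (hn : Kato.IsKolyvaginProduct W 3 1 n)
    (hcyc : ∀ (ℓ : ℕ) [Fact ℓ.Prime], ℓ ∣ n →
      Nat.card {P : ((integralModelInt W).map (Int.castRingHom (ZMod ℓ))).toAffine.Point //
        3 • P = 0} ≤ 3)
    (ψ : (ℓ : ℕ) → (ZMod ℓ)ˣ →* Multiplicative (ZMod (3 ^ 1)))
    (hψ : ∀ ℓ ∈ n.primeFactors, Function.Surjective (ψ ℓ))
    (hcert : kuriharaNumber D.f (3 ^ 1) n ψ ≠ 0)
    (hzero₁ : kuriharaNumber D.f (3 ^ 1) 1 ψ = 0)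
    (ψ₂₇ : (ℓ : ℕ) → (ZMod ℓ)ˣ →* Multiplicative (ZMod (3 ^ 3)))
    (hunit₁ : kuriharaNumber D.f (3 ^ 3) 1 ψ₂₇ ≠ 0) :
    BSDp W 3 := by
  haveI : Fact (Nat.Prime 3) := ⟨Nat.prime_three⟩
  have hadd : Addv W 3 := addv_of_intModel hI 3 (by exact_mod_cast hΔ) (by exact_mod_cast hc₄)
  have hc3 : ¬ 3 ∣ (W.baseChange ℚ_[3]).localTamagawaNumber ℤ_[3] := fun h =>
    htam (h.trans (localTamagawaNumber_padic_dvd_tamagawaProduct W 3))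
  have hsurj : W.HasSurjectiveModNGaloisRep ((3 : ℕ) : ℤ) := by simpa using htower 1
  have hsurj' : W.HasSurjectiveModNGaloisRep 3 := by simpa using htower 1
  -- rank `0`: `E(ℚ)`, `Ш` finite; `E[3]` irreducible
  have hGZ := hGZK W (by rw [hr]; exact zero_le_one)
  haveI : Finite W.sha := hGZ.2
  haveI : Finite W.toAffine.Point := W.mordellWeilRank_eq_zero_iff_holds.mp (by rw [hGZ.1, hr])
  have hirr : W.HasIrreducibleModPGaloisRep 3 :=
    hasIrreducibleModPGaloisRep_of_hasSurjectiveModNGaloisRep W 3 hsurj'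
  -- the optimal datum: `3 ∤ c_D`, the period transfer
  have hcD : ¬ (3 : ℤ) ∣ D.maninConstant :=
    not_dvd_maninConstant_of_level_le h26 W D hopt hN Nat.prime_three
  have hper : ∃ u : ℚ, ‖(u : ℚ_[3])‖ = 1 ∧ W.realPeriodRat = u * plusPeriod D.f :=
    periodTransfer_of_optimal 3 D hopt hcD
  have hcP : ¬ ((3 : ℕ) : ℤ) ∣ D.maninConstant := by exact_mod_cast hcD
  -- LOWER: Sel₃ ≠ 0 (END-m1) ⟹ 9 ∣ #Ш(3); then the socket with the level-zero witness
  have hSel := exists_ne_zero_mem_selmerGroup_three_of_port_of_kolyvaginProduct_of_baseRigidity W hadd hc3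
    hsurj ht0 D hcP hper inv hperf hsum hcompl hEP v₃ hv₃ hPort n hn hcyc ψ hψ hcert hzero₁
  have h9 := sq_dvd_card_sha_three_of_exists_selmer_ne_zero hCT W hirr hSel
  exact bsdp_three_of_towerSurj_of_sq_dvd_card_sha hKatoS hDel hGZK hmod hmodD hKatoχ h26 W hI hΔ hc₄
    htower hr htam hN D hopt h9 ψ₂₇ hunit₁

/-- **END-m1, RECORD COROLLARY on the potentially MULTIPLICATIVE rows (`ord₃ j < 0`, class A1-(M)) —
[S24]-FREE form.**  As `bsdp_three_of_towerSurj_of_levelOneCertificates_of_baseRigidity` with the UPPER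
half through additive-p1's `ω`-branch socket: NO tower, NO Tamagawa hypothesis beyond `3 ∤ c₃`, NO
Manin bound on the UPPER side (surj(3) and `ord₃ j < 0` instead); the LOWER side as there (the
optimal datum still feeds the period transfer of the `L`-value witness and the dictionary).
[cite: Kim2022StructureSelmer, Thm. 1.9 (6) and Thm. 3.13] [cite: Rubin2011, Thm. 2.8.4]
[cite: Delbourgo1998, Prop. 4 (p. 144)] [cite: AgasheRibetStein2006, Thm. 2.6 (p. 619)]
[cite: SilvermanAEC2009, Thm. X.4.14] -/
theorem bsdp_three_potMult_of_levelOneCertificates_of_baseRigidity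
    (hKatoS : Kato2004.rankZero_padicValNat_sha_le_sub_localTamagawa_of_additive_potGood_of_imageContainsSL2)
    (hDel : Delbourgo1998.prop4_rankZero_pow_dvd_constantCoeff)
    (hGZK : rank_eq_analyticRank_of_analyticRank_le_one) (hmod : hasEntireLFunction_rat)
    (hmodD : nonempty_modularParametrizationData)
    (hKatoχ : Wuthrich2014.kato_halfEigenCharIdeal_dvd_cyclotomicPrime_of_surjective)
    (h26 : cremona_abs_maninConstant_eq_one_of_level_le)
    (hCT : exists_casselsTate_pairing (K := ℚ))
    (W : WeierstrassCurve ℚ) [W.IsElliptic] [W.IsGloballyMinimal]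
    {E₀ : WeierstrassCurve ℤ} (hI : integralModelInt W = E₀)
    (hΔ : (3 : ℤ) ∣ E₀.Δ) (hc₄ : (3 : ℤ) ∣ E₀.c₄)
    (hsurj : W.HasSurjectiveModNGaloisRep ((3 : ℕ) : ℤ)) (hjneg : padicValRat 3 W.j < 0)
    (hc3 : ¬ 3 ∣ (W.baseChange ℚ_[3]).localTamagawaNumber ℤ_[3])
    (ht0 : Nat.card {Q : (W.baseChange ℚ_[3]).toAffine.Point // (3 : ℕ) • Q = 0} = 1)
    (hr : W.analyticRank = 0)
    {N : ℕ} [NeZero N] (hN : N ≤ 130000) (D : ModularParametrizationData W N)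
    (hopt : ∀ z ∈ D.L.lattice, ∃ w ∈ periodLattice D.f, z = D.c * w)
    (inv : LocalInvariants ℚ 3) (hperf : inv.IsPerfect) (hsum : inv.SumLocalTermEqZero)
    (hcompl : inv.SelmerComplement)
    (hEP : ∀ v : HeightOneSpectrum (𝓞 ℚ), localEulerPoincareCharacteristic (v.adicCompletion ℚ))
    (v₃ : HeightOneSpectrum (𝓞 ℚ)) (hv₃ : ((3 : ℕ) : 𝓞 ℚ) ∈ v₃.asIdeal)
    (hPort : KatoKuriharaPortThreeAt W 0 v₃)
    (n : ℕ) [NeZero n] (hn : Kato.IsKolyvaginProduct W 3 1 n)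
    (hcyc : ∀ (ℓ : ℕ) [Fact ℓ.Prime], ℓ ∣ n →
      Nat.card {P : ((integralModelInt W).map (Int.castRingHom (ZMod ℓ))).toAffine.Point //
        3 • P = 0} ≤ 3)
    (ψ : (ℓ : ℕ) → (ZMod ℓ)ˣ →* Multiplicative (ZMod (3 ^ 1)))
    (hψ : ∀ ℓ ∈ n.primeFactors, Function.Surjective (ψ ℓ))
    (hcert : kuriharaNumber D.f (3 ^ 1) n ψ ≠ 0)
    (hzero₁ : kuriharaNumber D.f (3 ^ 1) 1 ψ = 0)
    (ψ₂₇ : (ℓ : ℕ) → (ZMod ℓ)ˣ →* Multiplicative (ZMod (3 ^ 3)))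
    (hunit₁ : kuriharaNumber D.f (3 ^ 3) 1 ψ₂₇ ≠ 0) :
    BSDp W 3 := by
  haveI : Fact (Nat.Prime 3) := ⟨Nat.prime_three⟩
  have hadd : Addv W 3 := addv_of_intModel hI 3 (by exact_mod_cast hΔ) (by exact_mod_cast hc₄)
  have hsurj' : W.HasSurjectiveModNGaloisRep 3 := by simpa using hsurj
  have hGZ := hGZK W (by rw [hr]; exact zero_le_one)
  haveI : Finite W.sha := hGZ.2
  haveI : Finite W.toAffine.Point := W.mordellWeilRank_eq_zero_iff_holds.mp (by rw [hGZ.1, hr])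
  have hirr : W.HasIrreducibleModPGaloisRep 3 :=
    hasIrreducibleModPGaloisRep_of_hasSurjectiveModNGaloisRep W 3 hsurj'
  have hcD : ¬ (3 : ℤ) ∣ D.maninConstant :=
    not_dvd_maninConstant_of_level_le h26 W D hopt hN Nat.prime_three
  have hper : ∃ u : ℚ, ‖(u : ℚ_[3])‖ = 1 ∧ W.realPeriodRat = u * plusPeriod D.f :=
    periodTransfer_of_optimal 3 D hopt hcD
  have hcP : ¬ ((3 : ℕ) : ℤ) ∣ D.maninConstant := by exact_mod_cast hcD
  have hSel := exists_ne_zero_mem_selmerGroup_three_of_port_of_kolyvaginProduct_of_baseRigidity W hadd hc3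
    hsurj ht0 D hcP hper inv hperf hsum hcompl hEP v₃ hv₃ hPort n hn hcyc ψ hψ hcert hzero₁
  have h9 := sq_dvd_card_sha_three_of_exists_selmer_ne_zero hCT W hirr hSel
  exact bsdp_three_potMult_of_sq_dvd_card_sha hKatoS hDel hGZK hmod hmodD hKatoχ h26 W hI hΔ hc₄ hsurj'
    hjneg hr hN D hopt h9 ψ₂₇ hunit₁

end Summit.BirchSwinnertonDyer.Rank1Residual.GaloisImage.Assembly

end
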